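import Literature.NumberTheory.ModularForms.SiegelThetaConstantsDegreeOne
import Literature.Analysis.SpecialFunctions.RiemannThetaDiagonal
import Literature.Geometry.Kaehler.SiegelTorusThetaNullLocusOrbit
import HarnessLib

/-!
# Diagonal period matrices: `ϑ[ε;δ](diag(τ₁, …, τ_g)) = ∏ᵢ ϑ[εᵢ;δᵢ](τᵢ)`, `P₈(diag τ) = 2^g ∏ᵢ E₄(τᵢ)`,
# `P₈(i·1_g) = (2E₄(i))^g`, and the theta cusp form vanishes on the diagonal locus (`g ≥ 2`)

Layer `Literature/NumberTheory/ModularForms`, namespace `Literature.NumberTheory.ModularForms` (lane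
`lit-hodgefound`, Layer A4, theta-divisor row A4-17; prover seat `lit-hodgefound-p23`, row «A4-17(ai)»).
Sequel of `SiegelThetaConstantsDegreeOne.lean` (`riemannThetaChar_fin_one`, `P₈((τ)) = 2E₄(τ)`) and of the
tree's `RiemannThetaDiagonal.lean` (`riemannTheta_diagonal : ϑ(z, diag τ) = ∏ᵢ ϑ(zᵢ, τᵢ)` for the
characteristic `[0; 0]`), `SiegelThetaConstantsEighthPowers.lean` (`P₈(i·1_g)` is a positive real number)
and `SiegelTorusThetaNullLocusOrbit.lean` (`memThetaNull_diagonal_of_two_le`).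

## The source, as printed

H. Farkas, S. Grushevsky, R. Salvati Manni, *An explicit solution to the weak Schottky problem*, Algebr.
Geom. 8 (2021), §4 (arXiv:1710.02938, p. 11): "the theta constant of a diagonal period matrix decomposes as
a product **`θ[ε;δ](diag(t₁, …, t_g)) = θ[ε₁;δ₁](t₁) · … · θ[ε_g;δ_g](t_g)`**" (the tree had it for
`[ε; δ] = [0; 0]` only, `RiemannThetaDiagonal.lean`, and for TWO blocks of any size,
`RiemannThetaCharBlockDiagonal.lean`). With D'Hoker–Kaidi (3.7.19) `E₄ = ½(ϑ₂⁸ + ϑ₃⁸ + ϑ₄⁸)` in each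
coordinate (the tree's `thetaNullEighthPowerSum_one1`) and van der Geer §15 (p. 28) (the theta cusp form
`χ₁₀` vanishes on the locus of products of elliptic curves).

## What is here (theorems only; no definition, no named fact, net debt `0`)

* §1 **`riemannThetaChar_diagonal`**: `ϑ[a; b](z, diag τ) = ∏ᵢ ϑ[aᵢ; bᵢ]((zᵢ), (τᵢ))` for `Im τᵢ > 0`, all
  characteristics, with the variable `z` (factors on the degree-one Siegel carrier `one1 τᵢ`);
  **`riemannThetaChar_diagonal_zero`** (the printed display: theta constants);
* §2 `sum_chars_eq_sum_pi` (`(ℤ/2)^{2g} ≃ ((ℤ/2)²)^g`), **`thetaNullEighthPowerSum_diagonal :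
  P₈(diag τ) = ∏ᵢ P₈((τᵢ))`**, **`thetaNullEighthPowerSum_diagonal_coe : P₈(diag τ) = 2^g ∏ᵢ E₄(τᵢ)`**
  (`τᵢ ∈ ℍ`), `I_smul_one_eq_diagonal`, **`thetaNullEighthPowerSum_I_smul_one_eq_pow : P₈(i·1_g) = (2E₄(i))^g`**,
  and the degree-one consequence **`E₄_I_re_pos_and_im_eq_zero`**: Mathlib's `E₄(i)` is a positive real
  number (`2E₄(i) = P₈((i)) = (Σ_m e^{−πm²})⁸ + (Σ_m (−1)^m e^{−πm²})⁸ + (Σ_m e^{−π(m+½)²})⁸`);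
* §3 **`evenThetaNullProd_diagonal`**: `(∏_{m even} ϑ_m)(0, diag τ) = 0` for `g ≥ 2`, and
  `evenThetaNullProd_I_smul_one` (`= 0` at `i·1_g`, `g ≥ 2`).

Not here: the value `E₄(i) = 3Γ(¼)⁸/(2π)⁶`; non-diagonal period matrices.

## References

* [FarkasGrushevskySalvatimanni2021] H. M. Farkas, S. Grushevsky, R. Salvati Manni, Algebr. Geom. 8 (2021),
  §4 (arXiv:1710.02938, p. 11).
* [DhokerKaidi2024] E. D'Hoker, J. Kaidi, *Modular Forms and String Theory*, CUP (2024), §3.7.2 (3.7.19).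
* [vanderGeer2008] G. van der Geer, *Siegel modular forms and their applications* (2008), §9 (p. 18),
  §15 (p. 28).
* [MumfordTata1] D. Mumford, *Tata Lectures on Theta I* (1983), Ch. II §1, §5.
-/

noncomputable section

open Complex Real Matrix
open scoped MatrixGroups ModularForm UpperHalfPlane

namespace Literature.NumberTheory.ModularForms

open Literature.Analysis.SpecialFunctions (riemannThetaChar riemannThetaChar_eq_cexp_mul_riemannTheta
  riemannTheta_diagonal)
open Literature.Geometry.Kaehler.ComplexTorus (evenThetaNullProd evenThetaNullProd_eq_zero_iff
  memThetaNull_diagonal_of_two_le)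
open Literature.NumberTheory.Automorphic (siegelUpperHalfSpace)
open SiegelModularForm (one1 one1_apply)

variable {g : ℕ}

/-! ### §1 The theta functions with characteristics of a diagonal period matrix factorise -/

/-- **"The theta constant of a diagonal period matrix decomposes as a product
`θ[ε;δ](diag(t₁, …, t_g)) = θ[ε₁;δ₁](t₁) · … · θ[ε_g;δ_g](t_g)`"** — here with the variable `z` and
arbitrary characteristics: `ϑ[a; b](z, diag(τ)) = ∏ᵢ ϑ[aᵢ; bᵢ]((zᵢ), (τᵢ))` for `Im τᵢ > 0`, the factors being
the degree-one theta functions of the tree on the Siegel carrier `(τᵢ) = one1 τᵢ`. From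
`ϑ[a;b](z, Ω) = e(πi ᵗaΩa + 2πi ᵗa(z + b)) ϑ(z + Ωa + b, Ω)`, the tree's `riemannTheta_diagonal`
(`ϑ(w, diag τ) = ∏ᵢ ϑ(wᵢ, τᵢ)`) and the degree-one bridge `riemannThetaChar_fin_one`.
[cite: FarkasGrushevskySalvatimanni2021, §4 (arXiv p. 11)] -/
theorem riemannThetaChar_diagonal (a b z : Fin g → ℂ) (τ : Fin g → ℂ) (hτ : ∀ i, 0 < (τ i).im) :
    riemannThetaChar a b (Matrix.diagonal τ) z =
      ∏ i, riemannThetaChar (fun _ => a i) (fun _ => b i) (one1 (τ i)) (fun _ => z i) := by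
  have hsym : ∀ i j, Matrix.diagonal τ i j = Matrix.diagonal τ j i := fun i j => by
    by_cases h : i = j
    · subst h; rfl
    · rw [Matrix.diagonal_apply_ne _ h, Matrix.diagonal_apply_ne _ (Ne.symm h)]
  have hE : cexp (π * I * (a ⬝ᵥ (Matrix.diagonal τ *ᵥ a)) + 2 * π * I * (a ⬝ᵥ (z + b))) =
      ∏ i, cexp (π * I * a i ^ 2 * τ i + 2 * π * I * a i * (z i + b i)) := by
    rw [← Complex.exp_sum]
    congr 1
    simp only [dotProduct, Matrix.mulVec_diagonal, Pi.add_apply, Finset.mul_sum, ← Finset.sum_add_distrib]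
    exact Finset.sum_congr rfl fun i _ => by ring
  have hJ : ∀ i, (z + Matrix.diagonal τ *ᵥ a + b) i = z i + b i + a i * τ i := fun i => by
    simp only [Pi.add_apply, Matrix.mulVec_diagonal]
    ring
  rw [riemannThetaChar_eq_cexp_mul_riemannTheta _ hsym, riemannTheta_diagonal τ hτ, hE, ← Finset.prod_mul_distrib]
  refine Finset.prod_congr rfl fun i _ => ?_
  rw [riemannThetaChar_fin_one, hJ]
  rfl

/-- **The theta constants of a diagonal period matrix**: `ϑ[a; b](0, diag(τ)) = ∏ᵢ ϑ[aᵢ; bᵢ](0, (τᵢ))`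
(FGSM's display). [cite: FarkasGrushevskySalvatimanni2021, §4 (arXiv p. 11)] -/
theorem riemannThetaChar_diagonal_zero (a b : Fin g → ℂ) (τ : Fin g → ℂ) (hτ : ∀ i, 0 < (τ i).im) :
    riemannThetaChar a b (Matrix.diagonal τ) 0 =
      ∏ i, riemannThetaChar (fun _ => a i) (fun _ => b i) (one1 (τ i)) 0 := by
  rw [riemannThetaChar_diagonal a b 0 τ hτ]
  rfl

/-! ### §2 `P₈(diag τ) = ∏ᵢ P₈((τᵢ)) = 2^g ∏ᵢ E₄(τᵢ)` -/

/-- Sums over the characteristics `(ℤ/2)^{2g}` of a sum of products over the coordinates: the characteristics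
of `diag(τ)` are `g`-tuples of characteristics of degree one, `(ℤ/2)^{2g} ≃ ((ℤ/2)²)^g`.
[cite: FarkasGrushevskySalvatimanni2021, §4 (arXiv p. 11)] [cite: MumfordTata1, Ch. II §1] -/
theorem sum_chars_eq_sum_pi (F : (Fin g ⊕ Fin g → ZMod 2) → ℂ) :
    ∑ p, F p = ∑ q : Fin g → (Fin 1 ⊕ Fin 1 → ZMod 2),
      F (Sum.elim (fun i => q i (Sum.inl 0)) (fun i => q i (Sum.inr 0))) := by
  let e : (Fin g → (Fin 1 ⊕ Fin 1 → ZMod 2)) ≃ (Fin g ⊕ Fin g → ZMod 2) :=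
    { toFun := fun q => Sum.elim (fun i => q i (Sum.inl 0)) (fun i => q i (Sum.inr 0))
      invFun := fun p i => Sum.elim (fun _ => p (Sum.inl i)) (fun _ => p (Sum.inr i))
      left_inv := fun q => by
        funext i s
        rcases s with j | j
        · rw [Subsingleton.elim j 0]; rfl
        · rw [Subsingleton.elim j 0]; rfl
      right_inv := fun p => by
        funext s
        rcases s with i | i <;> rfl }
  exact (Fintype.sum_equiv e _ F fun _ => rfl).symm

/-- **`P₈` of a diagonal period matrix is the product of the degree-one `P₈`'s**:
`Σ_{m ∈ (ℤ/2)^{2g}} ϑ_m(0, diag τ)⁸ = ∏ᵢ Σ_{mᵢ ∈ (ℤ/2)²} ϑ_{mᵢ}(0, (τᵢ))⁸` (`Im τᵢ > 0`).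
[cite: FarkasGrushevskySalvatimanni2021, §4 (arXiv p. 11)] [cite: vanderGeer2008, §9 (p. 18)] -/
theorem thetaNullEighthPowerSum_diagonal (τ : Fin g → ℂ) (hτ : ∀ i, 0 < (τ i).im) :
    thetaNullEighthPowerSum (Matrix.diagonal τ) = ∏ i, thetaNullEighthPowerSum (one1 (τ i)) := by
  simp only [thetaNullEighthPowerSum_def]
  rw [Finset.prod_univ_sum, sum_chars_eq_sum_pi]
  refine Finset.sum_congr rfl fun q _ => ?_
  rw [riemannThetaChar_diagonal_zero _ _ τ hτ, ← Finset.prod_pow]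
  refine Finset.prod_congr rfl fun i _ => ?_
  simp only [Sum.elim_inl, Sum.elim_inr]
  congr 2
  · funext j; rw [Subsingleton.elim j 0]
  · funext j; rw [Subsingleton.elim j 0]

/-- **`Σ_m ϑ_m(0, diag(τ₁, …, τ_g))⁸ = 2^g · ∏ᵢ E₄(τᵢ)`** for `τᵢ ∈ ℍ` — the weight-`4` theta form on the
`g`-fold product of elliptic curves (`P₈((τ)) = 2E₄(τ)`, `thetaNullEighthPowerSum_one1`).
[cite: FarkasGrushevskySalvatimanni2021, §4 (arXiv p. 11)] [cite: DhokerKaidi2024, §3.7.2 (3.7.19)] -/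
theorem thetaNullEighthPowerSum_diagonal_coe (τ : Fin g → ℍ) :
    thetaNullEighthPowerSum (Matrix.diagonal fun i => ((τ i : ℍ) : ℂ)) = 2 ^ g * ∏ i, ModularForm.E₄ (τ i) := by
  rw [thetaNullEighthPowerSum_diagonal _ fun i => (τ i).im_pos]
  simp_rw [thetaNullEighthPowerSum_one1]
  rw [Finset.prod_mul_distrib, Finset.prod_const, Finset.card_univ, Fintype.card_fin]

/-- `i · 1_g = diag(i, …, i)`. [cite: MumfordTata1, Ch. II §5] -/
theorem I_smul_one_eq_diagonal : I • (1 : Matrix (Fin g) (Fin g) ℂ) = Matrix.diagonal fun _ => I := by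
  rw [← Matrix.diagonal_one, ← Matrix.diagonal_smul]
  congr 1
  funext i
  simp

/-- **`P₈(i · 1_g) = (2 E₄(i))^g`**: the closed form of the positive number `P₈(i·1_g)` of
`thetaNullEighthPowerSum_I_smul_one_re_pos` (the period matrix of `E_i^g`, `E_i = ℂ/(ℤ + iℤ)`).
[cite: FarkasGrushevskySalvatimanni2021, §4 (arXiv p. 11)] [cite: DhokerKaidi2024, §3.7.2 (3.7.19)] -/
theorem thetaNullEighthPowerSum_I_smul_one_eq_pow :
    thetaNullEighthPowerSum (I • (1 : Matrix (Fin g) (Fin g) ℂ)) = (2 * ModularForm.E₄ UpperHalfPlane.I) ^ g := by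
  have h := thetaNullEighthPowerSum_diagonal_coe (g := g) fun _ => UpperHalfPlane.I
  rw [Finset.prod_const, Finset.card_univ, Fintype.card_fin, ← mul_pow] at h
  rw [I_smul_one_eq_diagonal]
  exact h

/-- **`E₄(i)` is a positive real number** (degree one of the two previous facts: `2E₄(i) = P₈((i))` is real
with positive real part, `thetaNullEighthPowerSum_I_smul_one_eq` / `_re_pos`): `E₄(i) = (Re E₄(i) : ℂ)` and
`0 < Re E₄(i)`. [cite: DhokerKaidi2024, §3.7.2 (3.7.19)] [cite: MumfordTata1, Ch. II §5] -/
theorem E₄_I_re_pos_and_im_eq_zero :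
    0 < (ModularForm.E₄ UpperHalfPlane.I).re ∧ (ModularForm.E₄ UpperHalfPlane.I).im = 0 := by
  have h1 := thetaNullEighthPowerSum_I_smul_one_eq_pow (g := 1)
  rw [pow_one] at h1
  have hre := thetaNullEighthPowerSum_I_smul_one_re_pos (g := 1)
  have him : (thetaNullEighthPowerSum (I • (1 : Matrix (Fin 1) (Fin 1) ℂ))).im = 0 := by
    rw [thetaNullEighthPowerSum_I_smul_one_eq, Complex.ofReal_im]
  rw [h1] at hre him
  simp only [Complex.mul_re, Complex.mul_im, Complex.re_ofNat, Complex.im_ofNat, zero_mul, sub_zero, add_zero]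
    at hre him
  constructor
  · linarith
  · linarith

/-! ### §3 The theta cusp form vanishes on the diagonal locus (`g ≥ 2`) -/

/-- **`(∏_{m even} ϑ_m)(0, diag τ) = 0` for `g ≥ 2`** (`Im τᵢ > 0`): a diagonal period matrix — a product of
elliptic curves — lies on `θ_null` (`memThetaNull_diagonal_of_two_le`); the weight-`2^{g+1}(2^g+1)` theta
cusp form of `SiegelEvenThetaProductModularForm.lean` vanishes on the diagonal locus.
[cite: vanderGeer2008, §15 (p. 28)] [cite: FarkasGrushevskySalvatimanni2021, §4 (arXiv p. 11)] -/
theorem evenThetaNullProd_diagonal (hg : 2 ≤ g) (τ : Fin g → ℂ) (hτ : ∀ i, 0 < (τ i).im) :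
    evenThetaNullProd (Matrix.diagonal τ) = 0 :=
  (evenThetaNullProd_eq_zero_iff _).2 (memThetaNull_diagonal_of_two_le hg τ hτ)

/-- In particular `(∏_{m even} ϑ_m)(0, i·1_g) = 0` for `g ≥ 2`, while `P₈(i·1_g) = (2E₄(i))^g ≠ 0`.
[cite: vanderGeer2008, §15 (p. 28)] -/
theorem evenThetaNullProd_I_smul_one (hg : 2 ≤ g) : evenThetaNullProd (I • (1 : Matrix (Fin g) (Fin g) ℂ)) = 0 := by
  rw [I_smul_one_eq_diagonal]
  exact evenThetaNullProd_diagonal hg _ fun _ => by rw [Complex.I_im]; exact one_pos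

end Literature.NumberTheory.ModularForms
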